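import Literature.NumberTheory.DiophantineGeometry.SymmetricGroupReps
import Literature.NumberTheory.DiophantineGeometry.SymmetricGroupRepsYoungSymmetrizerNeZeroProofs
import Mathlib.RingTheory.TensorProduct.Finite
import Mathlib.LinearAlgebra.FreeModule.Finite.Matrix
import Mathlib.RingTheory.Bialgebra.MonoidAlgebra
import HarnessLib

/-!
# Kronecker coefficients with a one-row partition: `g((d), μ, μ) ≥ 1`

For the one-row partition `(d)` (Mathlib's `Nat.Partition.indiscrete d`) the Specht module
`S^{(d)} = k[S_d] · c_{(d)}` is the trivial representation, so `S^{(d)} ⊗ S^μ ≅ S^μ` and the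
Kronecker coefficient `g((d), μ, μ) = dim Hom_{S_d}(S^{(d)} ⊗ S^μ, S^μ)` (`kroneckerCoeff`,
`SymmetricGroupReps.lean`) is positive (indeed `1`, by Schur; only positivity is proved here).
This is the fact used silently throughout the combinatorics of rectangular Kronecker coefficients,
e.g. Ikenmeyer–Panova, Adv. Math. 319 (2017), proof of Lemma 4.2 (held arXiv text: Lemma 19):
"Clearly `g((k(a-ks)), k × (a-ks), k × (a-ks)) > 0`", and BIP 2019 §6(a) ("`(n)` occurs").

## Proof

With the canonical row-reading tableau of `PartitionTableaux.lean`, the one-row shape has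
`rowOf ≡ 0` and `colOf i = i` (`rowOf_indiscrete`, `colOf_indiscrete`), so its column stabilizer
is trivial and its row stabilizer is all of `S_d` (`colStabilizer_indiscrete`,
`rowStabilizer_indiscrete`); hence `b_{(d)} = 1` and `c_{(d)} = a_{(d)} = ∑_σ σ`. The augmentation
`ε : k[S_d] → k`, `σ ↦ 1` — Mathlib's counit of the bialgebra `k[S_d]`,
`Bialgebra.counitAlgHom k (MonoidAlgebra k S_d)`, abbreviated `augmentation` here — is an algebra
homomorphism invariant under left translation (`augmentation_of_mul`), with
`ε(c_{(d)}) = |S_d| ≠ 0` in characteristic zero (`augmentation_youngSymmetrizer_indiscrete_ne_zero`).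
For ANY two partitions `λ, μ ⊢ d` the map `S^λ ⊗ S^μ → S^μ`, `x ⊗ y ↦ ε(x) y`, is
`S_d`-equivariant (`augIntertwiner`: `σ` acts on `S^λ ⊆ k[S_d]` by left multiplication,
`spechtRep_apply`, and `ε(σ x) = ε(x)`); for `λ = (d)` it sends `c_{(d)} ⊗ c_μ` to
`ε(c_{(d)}) c_μ ≠ 0` (`youngSymmetrizer_ne_zero_holds`), so the intertwiner space is a nonzero
finite-dimensional `k`-space and `g((d), μ, μ) > 0` (`kroneckerCoeff_indiscrete_pos`).

## References

* G. D. James, *The Representation Theory of the Symmetric Groups*, LNM 682 (1978), §4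
  (Example 4.2/4.5: `S^{(n)}` is the trivial module). [JamesLNM682]
* W. Fulton, J. Harris, *Representation Theory. A First Course*, GTM 129 (1991), §4.1 (after
  (4.3): "`c_{(d)} = a_{(d)} = ∑_{g ∈ 𝔖_d} e_g` ... `V_{(d)}` the trivial representation") and
  Exercise 4.51 (Kronecker coefficients). [FultonHarrisGTM129]
* C. Ikenmeyer, G. Panova, Adv. Math. 319 (2017) 40–66, proof of Lemma 4.2 (held: Lemma 19).
  [IkenmeyerPanova2017]

## Mathlib

`Bialgebra.counitAlgHom` with `MonoidAlgebra.counit_single` (the augmentation IS this Mathlib map;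
no parallel API is built: `augmentation` is an `abbrev` for it and `augmentation_eq_counitAlgHom`
is `rfl`), `Representation.tprod_apply`, `TensorProduct.lid`,
`TensorProduct.map_tmul`, `TensorProduct.ext'`, `Representation.IntertwiningMap` (its
`Module.Finite` instance `Representation.IntertwiningMap.instFiniteOfIsNoetherian`, applied with
the `AddCommGroup` structure of the tensor product supplied explicitly, since instance search does
not see through `TensorProduct.addCommMonoid` here), `Module.finrank_pos`,
`Nat.Partition.indiscrete` (`indiscrete_parts`).
-/

noncomputable section

open scoped BigOperators TensorProduct

namespace Literature.NumberTheory.DiophantineGeometry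

/-! ### The canonical tableau of the one-row shape -/

section OneRow

variable {d : ℕ}

/-- The one-row partition `(d)` has sorted parts `[d]` (`d ≠ 0`). [folklore] -/
theorem sortedParts_indiscrete (hd : d ≠ 0) : (Nat.Partition.indiscrete d).sortedParts = [d] := by
  simp [Nat.Partition.sortedParts, Nat.Partition.indiscrete_parts hd]

/-- Every box of the one-row shape lies in row `0` of the canonical row-reading tableau
(Fulton, *Young Tableaux*, §7.1). [folklore] -/
theorem rowOf_indiscrete (i : Fin d) : (Nat.Partition.indiscrete d).rowOf i = 0 := by
  have hd : d ≠ 0 := Nat.pos_iff_ne_zero.mp (Fin.pos i)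
  have h := (Nat.Partition.indiscrete d).rowOf_lt_length i
  rw [sortedParts_indiscrete hd, List.length_singleton] at h
  omega

/-- Box `i` of the one-row shape lies in column `i`. [folklore] -/
theorem colOf_indiscrete (i : Fin d) : (Nat.Partition.indiscrete d).colOf i = i := by
  simp [Nat.Partition.colOf, rowOf_indiscrete]

/-- The column stabilizer of the one-row tableau is trivial (all columns are singletons;
Fulton–Harris §4.1: `Q_{(d)} = 1`, so `b_{(d)} = 1`). [cite: FultonHarrisGTM129, §4.1 (after (4.3))] -/
theorem colStabilizer_indiscrete : colStabilizer (Nat.Partition.indiscrete d) = ⊥ := by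
  refine (Subgroup.eq_bot_iff_forall _).2 fun σ hσ => ?_
  ext i
  have h := (mem_colStabilizer_iff _ σ).1 hσ i
  simpa [colOf_indiscrete] using h

/-- The row stabilizer of the one-row tableau is all of `S_d` (Fulton–Harris §4.1: `P_{(d)} = 𝔖_d`,
so `c_{(d)} = a_{(d)} = ∑_g e_g`). [cite: FultonHarrisGTM129, §4.1 (after (4.3))] -/
theorem rowStabilizer_indiscrete : rowStabilizer (Nat.Partition.indiscrete d) = ⊤ := by
  refine eq_top_iff.2 fun σ _ => (mem_rowStabilizer_iff _ σ).2 fun i => ?_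
  simp [rowOf_indiscrete]

end OneRow

/-! ### The augmentation of `k[S_d]` -/

section Augmentation

variable (k : Type*) [Field k] {d : ℕ}

/-- The augmentation `ε : k[S_d] →ₐ[k] k`, `∑ a_σ σ ↦ ∑ a_σ` (the trivial character extended
linearly). This is Mathlib's counit of the group bialgebra, `Bialgebra.counitAlgHom k k[S_d]`
(`Mathlib.RingTheory.Bialgebra.MonoidAlgebra`), of which `augmentation` is only a readable
abbreviation (`augmentation_eq_counitAlgHom` is `rfl`). James, LNM 682, §4 (the trivial module
`S^{(n)}`). [folklore] -/
abbrev augmentation (d : ℕ) : MonoidAlgebra k (Equiv.Perm (Fin d)) →ₐ[k] k :=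
  Bialgebra.counitAlgHom k (MonoidAlgebra k (Equiv.Perm (Fin d)))

/-- Bridge to Mathlib: the augmentation is the counit algebra map of `k[S_d]` (by definition).
[folklore] -/
theorem augmentation_eq_counitAlgHom (d : ℕ) :
    augmentation k d = Bialgebra.counitAlgHom k (MonoidAlgebra k (Equiv.Perm (Fin d))) :=
  rfl

/-- `ε(σ) = 1` for a group element (Mathlib `MonoidAlgebra.counit_single`). [folklore] -/
theorem augmentation_of (σ : Equiv.Perm (Fin d)) :
    augmentation k d (MonoidAlgebra.of k _ σ) = 1 := by
  simp [MonoidAlgebra.of_apply]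

/-- The augmentation is invariant under left translation: `ε(σ x) = ε(x)`. [folklore] -/
theorem augmentation_of_mul (σ : Equiv.Perm (Fin d)) (x : MonoidAlgebra k (Equiv.Perm (Fin d))) :
    augmentation k d (MonoidAlgebra.of k _ σ * x) = augmentation k d x := by
  rw [map_mul, augmentation_of, one_mul]

open scoped Classical in
/-- `ε(a_μ) = |R_μ| ≠ 0` in characteristic zero (the row symmetrizer is a sum of `|R_μ| ≥ 1` group
elements). [folklore] -/
theorem augmentation_rowSymmetrizer_ne_zero [CharZero k] (μ : Nat.Partition d) :
    augmentation k d (rowSymmetrizer k μ) ≠ 0 := by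
  unfold rowSymmetrizer
  rw [map_sum]
  simp only [augmentation_of, Finset.sum_const, nsmul_eq_mul, mul_one]
  exact Nat.cast_ne_zero.2 (Finset.card_pos.2 ⟨1, Set.mem_toFinset.2 (one_mem _)⟩).ne'

open scoped Classical in
/-- If the column stabilizer is trivial then `b_μ = 1 · e_1` and `ε(b_μ) = 1`. [folklore] -/
theorem augmentation_colAntisymmetrizer_of_eq_bot {μ : Nat.Partition d}
    (h : colStabilizer μ = ⊥) : augmentation k d (colAntisymmetrizer k μ) = 1 := by
  unfold colAntisymmetrizer
  have hS : (colStabilizer μ : Set (Equiv.Perm (Fin d))).toFinset = {1} := by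
    ext σ
    simp [h]
  rw [hS, Finset.sum_singleton, map_smul, augmentation_of]
  simp

/-- `ε(c_{(d)}) ≠ 0` in characteristic zero: `c_{(d)} = a_{(d)} b_{(d)}` with `ε(b_{(d)}) = 1`
(`colStabilizer_indiscrete`) and `ε(a_{(d)}) = d! ≠ 0`. Fulton–Harris §4.1:
`c_{(d)} = ∑_{g ∈ 𝔖_d} e_g`. [cite: FultonHarrisGTM129, §4.1 (after (4.3))] -/
theorem augmentation_youngSymmetrizer_indiscrete_ne_zero [CharZero k] :
    augmentation k d (youngSymmetrizer k (Nat.Partition.indiscrete d)) ≠ 0 := by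
  rw [youngSymmetrizer, map_mul,
    augmentation_colAntisymmetrizer_of_eq_bot k colStabilizer_indiscrete, mul_one]
  exact augmentation_rowSymmetrizer_ne_zero k _

end Augmentation

/-! ### The intertwiner `S^λ ⊗ S^μ → S^μ`, `x ⊗ y ↦ ε(x) y`, and `g((d), μ, μ) > 0` -/

section Intertwiner

variable (k : Type*) [Field k] {d : ℕ}

/-- The `k`-linear augmentation restricted to a Specht module `S^λ ⊆ k[S_d]`. [folklore] -/
def spechtAugmentation (lam : Nat.Partition d) : spechtIdeal k lam →ₗ[k] k :=
  (augmentation k d).toLinearMap ∘ₗ ((spechtIdeal k lam).subtype.restrictScalars k)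

/-- Unfolding lemma for `spechtAugmentation`. [folklore] -/
@[simp] theorem spechtAugmentation_apply (lam : Nat.Partition d) (x : spechtIdeal k lam) :
    spechtAugmentation k lam x = augmentation k d (x : MonoidAlgebra k (Equiv.Perm (Fin d))) :=
  rfl

/-- The `S_d`-equivariant map `S^λ ⊗ S^μ → S^μ`, `x ⊗ y ↦ ε(x) y`: `σ` acts on `S^λ` by left
multiplication (`spechtRep_apply`) and `ε(σ x) = ε(x)`, so
`Φ(σx ⊗ σy) = ε(x) σy = σ Φ(x ⊗ y)`. For `λ = (d)` this is the isomorphism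
`triv ⊗ S^μ ≅ S^μ` up to the scalar `ε(c_{(d)})` (James, LNM 682, §4). [folklore] -/
def augIntertwiner (lam μ : Nat.Partition d) :
    ((spechtRep k lam).tprod (spechtRep k μ)).IntertwiningMap (spechtRep k μ) where
  toLinearMap := (TensorProduct.lid k (spechtIdeal k μ)).toLinearMap ∘ₗ
    TensorProduct.map (spechtAugmentation k lam) LinearMap.id
  isIntertwining' g := by
    apply TensorProduct.ext'
    intro x y
    simp only [LinearMap.coe_comp, LinearEquiv.coe_coe, Function.comp_apply,
      Representation.tprod_apply, TensorProduct.map_tmul, LinearMap.id_coe, id_eq,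
      TensorProduct.lid_tmul, spechtAugmentation_apply, map_smul]
    congr 1
    rw [spechtRep_apply, augmentation_of_mul]

/-- `augIntertwiner` on pure tensors: `x ⊗ y ↦ ε(x) • y`. [folklore] -/
theorem augIntertwiner_tmul (lam μ : Nat.Partition d) (x : spechtIdeal k lam)
    (y : spechtIdeal k μ) :
    augIntertwiner k lam μ (x ⊗ₜ y) = augmentation k d (x : MonoidAlgebra k _) • y := by
  simp [augIntertwiner]

/-- For the one-row shape the intertwiner is nonzero (characteristic zero): it sends
`c_{(d)} ⊗ c_μ` to `ε(c_{(d)}) c_μ`, a nonzero multiple (`augmentation_youngSymmetrizer_indiscrete_ne_zero`)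
of the nonzero Young symmetrizer (`youngSymmetrizer_ne_zero_holds`). [folklore] -/
theorem augIntertwiner_indiscrete_ne_zero [CharZero k] (μ : Nat.Partition d) :
    augIntertwiner k (Nat.Partition.indiscrete d) μ ≠ 0 := by
  intro h
  have h1 := congrArg (fun f => (f (⟨_, youngSymmetrizer_mem_spechtIdeal k
      (Nat.Partition.indiscrete d)⟩ ⊗ₜ ⟨_, youngSymmetrizer_mem_spechtIdeal k μ⟩) :
      MonoidAlgebra k (Equiv.Perm (Fin d)))) h
  simp only [augIntertwiner_tmul] at h1
  have h2 : augmentation k d (youngSymmetrizer k (Nat.Partition.indiscrete d)) •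
      youngSymmetrizer k μ = 0 := by
    simpa using h1
  exact smul_ne_zero (augmentation_youngSymmetrizer_indiscrete_ne_zero k)
    (youngSymmetrizer_ne_zero_holds k μ) h2

/-- **`g((d), μ, μ) ≥ 1`** for every partition `μ ⊢ d`, over any field of characteristic zero: the
intertwiner space `Hom_{S_d}(S^{(d)} ⊗ S^μ, S^μ)` defining `kroneckerCoeff k (d) μ μ` is a
finite-dimensional `k`-space containing the nonzero `augIntertwiner`. Equivalently `S^{(d)}` is the
trivial representation (James, LNM 682, §4; Fulton–Harris §4.1) and `triv ⊗ S^μ ≅ S^μ`; used as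
"clearly `g((N), k × M, k × M) > 0`" in Ikenmeyer–Panova, proof of Lemma 4.2 (held: Lemma 19).
[cite: IkenmeyerPanova2017, Lemma 4.2 (proof; held: Lemma 19)] -/
theorem kroneckerCoeff_indiscrete_pos [CharZero k] (μ : Nat.Partition d) :
    0 < kroneckerCoeff k (Nat.Partition.indiscrete d) μ μ := by
  set M := ((spechtRep k (Nat.Partition.indiscrete d)).tprod (spechtRep k μ)).IntertwiningMap
      (spechtRep k μ)
  haveI : Nontrivial M := nontrivial_of_ne _ _ (augIntertwiner_indiscrete_ne_zero k μ)
  -- finite-dimensionality of the intertwiner space (Mathlib's instance, with the `AddCommGroup`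
  -- structure of the tensor product supplied explicitly)
  haveI : Module.Finite k M :=
    @Representation.IntertwiningMap.instFiniteOfIsNoetherian k (Equiv.Perm (Fin d))
      (↥(spechtIdeal k (Nat.Partition.indiscrete d)) ⊗[k] ↥(spechtIdeal k μ)) ↥(spechtIdeal k μ) _ _
      inferInstance inferInstance _ _
      ((spechtRep k (Nat.Partition.indiscrete d)).tprod (spechtRep k μ)) (spechtRep k μ)
      inferInstance inferInstance
  have h : 0 < Module.finrank k M := Module.finrank_pos (R := k) (M := M)
  exact h

end Intertwiner

end Literature.NumberTheory.DiophantineGeometry
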